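import Summits.BirchSwinnertonDyer.BirchSwinnertonDyer.Theorems.PrintX10bStubAH4AtSOfExactAtP
import Literature.NumberTheory.EllipticCurves.ZpExtensionEisensteinDVRSettingH4AnnSatOfLiftsProofs
import Literature.NumberTheory.EllipticCurves.OrdinaryReductionAscentProofs
import Literature.NumberTheory.EllipticCurves.TorsionFilAtCyclicOfFrobeniusTraceProofs
import HarnessLib

/-!
# STUB A of the shared μ-item — the (ANN-SAT) half of `Stmt.exactAtP` on the Thm 4.1.3 frames (x9-p1-w4 g8)

Helper toward the registered stub `stub_h4AtS` of the shared deciding μ-item (`MuInequalityCoherentPairOfPrintCG`,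
stmt-BirchSwinnertonDyer-23428), in the letters of the D1 assembly v3 (`HeegnerMuPartH4AtS.Stmt.exactAtP`,
`Theorems/PrintX10bStubAH4AtSOfExactAtP`, p672535).  `Stmt.exactAtP` asks, at every place `v ∣ p` of `S` and every tower
level `k`, for the two limit statements (Exact) of `Tower.levelCondition_mem_iff_forall_pairing_eq_zero`; each is
(EXACT-REP) ∘ (ANN-SAT) (memo `HOME/p1/H4-EXACT-AT-P-PLAN-x10b-p1-g8.md` §1).  This file delivers the (ANN-SAT) halves ON THE
FRAMES: under the binders of `Stmt.exactAtP` VERBATIM (threshold `m₅` depending on `S` only), at every `v ∈ S` above `p`,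
(Y) a compatible family of `(H¹(K_v, Tw T^{(j)}))_j` orthogonal to the saturated strict-ordinary families is saturated for the
transported strict ordinary cores, and (X) the flipped twin — by the kernel theorems
`eisensteinTower_mem_saturatedFamilies_of_forall_localCup[_flip]_eq_zero_ofLifts'` (p672715/p672855), the frame facts
(`hyp.ordinary`, good reduction and an ordinary point at `w ∣ p`: `hasGoodReductionAt_baseChange_of_hasGoodReductionAtPrime`,
`exists_ordinaryPoint_local_of_not_dvd_frobeniusTraceAt`), `decomp v ⊄ ker κ⁻` above `p`
(`decomp_not_le_kerSubgroup_of_mem_or_mem`) with (B4)'s `exists_toAdd_apply_absGaloisRestrict_eq_pow_of_not_decomp_le` /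
`toAdd_apply_conj_absGaloisRestrict_inv_eq_of_anticyclotomic` (`κ⁻` anticyclotomic, `toAdd_conjGalCMH_eq_neg`), and the
threshold `m₅ := 1 + sup_{v ∈ S} 2 p^{s_v}`.  Bookkeeping toward one stub of one crux; no summit statement is proved here;
BSD is not proved by any of this.
-/

set_option linter.dupNamespace false
set_option autoImplicit false

noncomputable section

open scoped Classical Pointwise ContRepresentation TensorProduct NumberField

open Function NumberField IsDedekindDomain Field
open Literature Literature.NumberTheory.EllipticCurves WeierstrassCurve
open Literature.NumberTheory.GaloisCohomology Literature.NumberTheory.GaloisCohomology.Howard2004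
open Literature.NumberTheory.GaloisRepresentations Literature.NumberTheory.GaloisRepresentations.DiscreteGaloisModule
open Literature.NumberTheory.Automorphic
open Literature.NumberTheory.EllipticCurves.ZpExtension (EisensteinLevel)
open Summit.BirchSwinnertonDyer.BirchSwinnertonDyer.Theorems


namespace Summit.BirchSwinnertonDyer.BirchSwinnertonDyer.Theorems.HeegnerMuPartH4AtSAnnSat

set_option synthInstance.maxHeartbeats 80000 in
set_option maxHeartbeats 1600000 in
/-- **The (ANN-SAT) half of `Stmt.exactAtP` on the frames** — statement = the body of D1's letter
`HeegnerMuPartH4AtS.Stmt.annSatAtP` (LEAD `bsd-line-x10b-p1` g9, `Theorems/PrintX10bStubAExactAtPOfClauses.lean`) VERBATIM, so that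
`(annSatAtP : HeegnerMuPartH4AtS.Stmt.annSatAtP)` by `exact`; under the binders of `HeegnerMuPartH4AtS.Stmt.exactAtP` (p672535) verbatim and for all `m ≥ m₅(S)`, at every `v ∈ S` above `p`:
(Y) `∀ ζ` compatible in `(H¹(K_v, Tw T^{(j)}))_j`, orthogonal at every level to the families saturated for the strict ordinary cores
at `v` ⇒ `ζ` is saturated for the transported strict ordinary cores from `σ•v`; (X) the flipped twin.
[cite: Howard2004HeegnerKolyvagin, §1.3 H.4, Lemma 3.1.1 and Def. 3.2.6 (arXiv p. 7 L78–82, p. 15–16)]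
[cite: MilneADT2006, Ch. I Cor. 2.3 and Thm. 2.6] -/
theorem annSatAtP :
  ∀ (N : ℕ) [NeZero N] (W : WeierstrassCurve ℚ) [W.IsGloballyMinimal] (K : Type) [Field K] [NumberField K]
    (p : ℕ) [Fact p.Prime] (κ : ZpExtension K p) (γ : Field.absoluteGaloisGroup K)
    (hyp : CastellaGrossiLeeSkinner2022.Thm413Hypotheses N W K p κ γ),
    W.HasIrreducibleModPGaloisRep p → (W.baseChange K).HasIrreducibleModPGaloisRep p →
    haveI := hyp.isElliptic
    ∀ (S : Finset (HeightOneSpectrum (𝓞 K)))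
      (hpS : ∀ v, ((p : ℕ) : 𝓞 K) ∈ v.asIdeal → v ∈ S)
      (hbad : ∀ v, v ∉ S → ((p : ℕ) : 𝓞 K) ∉ v.asIdeal → (W.baseChange K).HasGoodReductionAt v),
    (∀ v ∈ S, ((p : ℕ) : 𝓞 K) ∈ v.asIdeal ∨ ((N : ℕ) : 𝓞 K) ∈ v.asIdeal) →
    (∀ (σ : K ≃ₐ[ℚ] K) (v : HeightOneSpectrum (𝓞 K)), σ • v ∈ S → v ∈ S) →
    ∃ m₅ : ℕ, ∀ (m : ℕ) (hm : 1 ≤ m), m₅ ≤ m →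
      letI := IwasawaAlgebra.isDomain_quotient_X_pow_add_C p hm
      letI := IwasawaAlgebra.isDiscreteValuationRing_quotient_X_pow_add_C p hm
      haveI := IwasawaAlgebra.EisensteinCoeff.isLocalRing_succ p hm
      letI := IwasawaAlgebra.EisensteinCoeff.algebraOfSpecSucc p m
      haveI := W.isScalarTower_algebraOfSpecSucc (K := K) (p := p) (m := m)
      letI := W.residueModuleSucc (K := K) (p := p) hm
      ∀ (L : Set (HeightOneSpectrum (𝓞 K)))
        (hL : L ⊆ (W.eisensteinTower (κ.unitTwist (-1)) hm).degreeTwoPrimes p) (hLS : ∀ v ∈ L, v ∉ S)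
        (c₀ : absoluteGaloisGroup ℚ) (σ : K ≃ₐ[ℚ] K) (hσ₁ : σ ≠ 1) (hσ : σ * σ = 1)
        (hτl : IsLiftOfAut σ (absGaloisTransport (K := ℚ) (L := K) c₀).toRingEquiv)
        (hτ₂ : Function.Involutive (absGaloisTransport (K := ℚ) (L := K) c₀).toRingEquiv)
        (D : ∀ k, DualityDatum p (ConjugationDatum.ofLifts σ hσ₁ hσ _ hτl hτ₂)
          ((W.eisensteinTower (κ.unitTwist (-1)) hm).ρ k) (IwasawaAlgebra.EisensteinCoeff p m (k + 1)))
        (e : ∀ j : ℕ, geomTorsion (W.baseChange K) ((p : ℤ) ^ j) →+ geomTorsion (W.baseChange K) ((p : ℤ) ^ j) →+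
          MuCarrier K (p ^ j))
        (log : ∀ j : ℕ, MuCarrier K (p ^ j) →+ ZMod (p ^ j)),
        IsComplexConjugation (Rat.castHom ℝ) c₀ →
        (∀ x, (ConjugationDatum.ofLifts σ hσ₁ hσ _ hτl hτ₂).τ x = absGaloisTransport (K := ℚ) (L := K) c₀ x) →
        (∀ k, (D k).e = ZpExtension.eisensteinDualityForm hm (k + 1)
          (conjPairing (e (k + 1)) ((ConjugationDatum.ofLifts σ hσ₁ hσ _ hτl hτ₂).isLift.torsionMap W _)
            (log (k + 1)))) →
        (∀ k (x y : EisensteinLevel p m (fun j ↦ geomTorsion (W.baseChange K) ((p : ℤ) ^ j)) (k + 1 + 1)),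
          IwasawaAlgebra.EisensteinCoeff.reduce p m (Nat.le_succ (k + 1)) ((D (k + 1)).e x y) =
            (D k).e ((W.eisensteinTower (κ.unitTwist (-1)) hm).red k x) ((W.eisensteinTower (κ.unitTwist (-1)) hm).red k y)) →
        (∀ j a, e j a a = 0) →
        (∀ j (g : absoluteGaloisGroup K) a b, e j (g • a) (g • b) = mu K (p ^ j) g (e j a b)) →
        (∀ j a b, e j ((ConjugationDatum.ofLifts σ hσ₁ hσ _ hτl hτ₂).isLift.torsionMap W _ a)
          ((ConjugationDatum.ofLifts σ hσ₁ hσ _ hτl hτ₂).isLift.torsionMap W _ b) = -e j a b) →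
        (∀ j (a : geomTorsion (W.baseChange K) ((p : ℤ) ^ j)),
          (ConjugationDatum.ofLifts σ hσ₁ hσ _ hτl hτ₂).isLift.torsionMap W _
            ((ConjugationDatum.ofLifts σ hσ₁ hσ _ hτl hτ₂).isLift.torsionMap W _ a) = a) →
        (∀ j, Function.Bijective (log j)) →
        (∀ j (g : absoluteGaloisGroup K) ξ, log j (mu K (p ^ j) g ξ) = cyclotomicCharacterModPow K p j g * log j ξ) →
        ∀ (v : HeightOneSpectrum (𝓞 K)), v ∈ S → ((p : ℕ) : 𝓞 K) ∈ v.asIdeal →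
          (∀ ζ ∈ Tower.compatibleFamilies (H := fun j ↦ galoisCohomology (((ConjugationDatum.ofLifts σ hσ₁ hσ _ hτl hτ₂).twist ((W.eisensteinTower (κ.unitTwist (-1)) hm).ρ j)).toLocal (Sum.inr v)) 1)
              (fun j ↦ ContinuousRep.cohomologyMap (((ConjugationDatum.ofLifts σ hσ₁ hσ _ hτl hτ₂).twist ((W.eisensteinTower (κ.unitTwist (-1)) hm).ρ (j + 1))).toLocal (Sum.inr v))
            (((ConjugationDatum.ofLifts σ hσ₁ hσ _ hτl hτ₂).twist ((W.eisensteinTower (κ.unitTwist (-1)) hm).ρ j)).toLocal (Sum.inr v)) ((W.eisensteinTower (κ.unitTwist (-1)) hm).red j).toAddMonoidHom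
            continuous_of_discreteTopology (fun _ z => (W.eisensteinTower (κ.unitTwist (-1)) hm).red_equivariant j _ z) 1),
            (∀ (j : ℕ), ∀ ξ ∈ Tower.saturatedFamilies (H := fun j ↦ galoisCohomology (((W.eisensteinTower (κ.unitTwist (-1)) hm).ρ j).toLocal (Sum.inr v)) 1)
                (fun j ↦ ContinuousRep.cohomologyMap (((W.eisensteinTower (κ.unitTwist (-1)) hm).ρ (j + 1)).toLocal (Sum.inr v))
            (((W.eisensteinTower (κ.unitTwist (-1)) hm).ρ j).toLocal (Sum.inr v)) ((W.eisensteinTower (κ.unitTwist (-1)) hm).red j).toAddMonoidHom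
            continuous_of_discreteTopology (fun _ z => (W.eisensteinTower (κ.unitTwist (-1)) hm).red_equivariant j _ z) 1) p
                (fun j ↦ ((W.baseChange K).ordinaryFiltrationAt v (fun j ↦ (W.baseChange K).torsionGaloisModuleReduce p j) (fun _ _ ↦ rfl)).ordinaryCore hm (j + 1)),
              (D j).localCup (Sum.inr v) (ξ j) (ζ j) = 0) →
            ζ ∈ Tower.saturatedFamilies (H := fun j ↦ galoisCohomology (((ConjugationDatum.ofLifts σ hσ₁ hσ _ hτl hτ₂).twist ((W.eisensteinTower (κ.unitTwist (-1)) hm).ρ j)).toLocal (Sum.inr v)) 1)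
                (fun j ↦ ContinuousRep.cohomologyMap (((ConjugationDatum.ofLifts σ hσ₁ hσ _ hτl hτ₂).twist ((W.eisensteinTower (κ.unitTwist (-1)) hm).ρ (j + 1))).toLocal (Sum.inr v))
            (((ConjugationDatum.ofLifts σ hσ₁ hσ _ hτl hτ₂).twist ((W.eisensteinTower (κ.unitTwist (-1)) hm).ρ j)).toLocal (Sum.inr v)) ((W.eisensteinTower (κ.unitTwist (-1)) hm).red j).toAddMonoidHom
            continuous_of_discreteTopology (fun _ z => (W.eisensteinTower (κ.unitTwist (-1)) hm).red_equivariant j _ z) 1) p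
                (fun j ↦ (((W.baseChange K).ordinaryFiltrationAt ((ConjugationDatum.ofLifts σ hσ₁ hσ _ hτl hτ₂).σ • v) (fun j ↦ (W.baseChange K).torsionGaloisModuleReduce p j) (fun _ _ ↦ rfl)).ordinaryCore hm (j + 1)).map
            ((ConjugationDatum.ofLifts σ hσ₁ hσ _ hτl hτ₂).transportH1 ((κ.unitTwist (-1)).eisensteinTwist ((W.baseChange K).torsionGaloisModule ((p : ℤ) ^ (j + 1))) hm (j + 1)) v))) ∧
          (∀ ζ ∈ Tower.compatibleFamilies (H := fun j ↦ galoisCohomology (((W.eisensteinTower (κ.unitTwist (-1)) hm).ρ j).toLocal (Sum.inr v)) 1)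
              (fun j ↦ ContinuousRep.cohomologyMap (((W.eisensteinTower (κ.unitTwist (-1)) hm).ρ (j + 1)).toLocal (Sum.inr v))
            (((W.eisensteinTower (κ.unitTwist (-1)) hm).ρ j).toLocal (Sum.inr v)) ((W.eisensteinTower (κ.unitTwist (-1)) hm).red j).toAddMonoidHom
            continuous_of_discreteTopology (fun _ z => (W.eisensteinTower (κ.unitTwist (-1)) hm).red_equivariant j _ z) 1),
            (∀ (j : ℕ), ∀ η ∈ Tower.saturatedFamilies (H := fun j ↦ galoisCohomology (((ConjugationDatum.ofLifts σ hσ₁ hσ _ hτl hτ₂).twist ((W.eisensteinTower (κ.unitTwist (-1)) hm).ρ j)).toLocal (Sum.inr v)) 1)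
                (fun j ↦ ContinuousRep.cohomologyMap (((ConjugationDatum.ofLifts σ hσ₁ hσ _ hτl hτ₂).twist ((W.eisensteinTower (κ.unitTwist (-1)) hm).ρ (j + 1))).toLocal (Sum.inr v))
            (((ConjugationDatum.ofLifts σ hσ₁ hσ _ hτl hτ₂).twist ((W.eisensteinTower (κ.unitTwist (-1)) hm).ρ j)).toLocal (Sum.inr v)) ((W.eisensteinTower (κ.unitTwist (-1)) hm).red j).toAddMonoidHom
            continuous_of_discreteTopology (fun _ z => (W.eisensteinTower (κ.unitTwist (-1)) hm).red_equivariant j _ z) 1) p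
                (fun j ↦ (((W.baseChange K).ordinaryFiltrationAt ((ConjugationDatum.ofLifts σ hσ₁ hσ _ hτl hτ₂).σ • v) (fun j ↦ (W.baseChange K).torsionGaloisModuleReduce p j) (fun _ _ ↦ rfl)).ordinaryCore hm (j + 1)).map
            ((ConjugationDatum.ofLifts σ hσ₁ hσ _ hτl hτ₂).transportH1 ((κ.unitTwist (-1)).eisensteinTwist ((W.baseChange K).torsionGaloisModule ((p : ℤ) ^ (j + 1))) hm (j + 1)) v)),
              (D j).localCup (Sum.inr v) (ζ j) (η j) = 0) →
            ζ ∈ Tower.saturatedFamilies (H := fun j ↦ galoisCohomology (((W.eisensteinTower (κ.unitTwist (-1)) hm).ρ j).toLocal (Sum.inr v)) 1)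
                (fun j ↦ ContinuousRep.cohomologyMap (((W.eisensteinTower (κ.unitTwist (-1)) hm).ρ (j + 1)).toLocal (Sum.inr v))
            (((W.eisensteinTower (κ.unitTwist (-1)) hm).ρ j).toLocal (Sum.inr v)) ((W.eisensteinTower (κ.unitTwist (-1)) hm).red j).toAddMonoidHom
            continuous_of_discreteTopology (fun _ z => (W.eisensteinTower (κ.unitTwist (-1)) hm).red_equivariant j _ z) 1) p
                (fun j ↦ ((W.baseChange K).ordinaryFiltrationAt v (fun j ↦ (W.baseChange K).torsionGaloisModuleReduce p j) (fun _ _ ↦ rfl)).ordinaryCore hm (j + 1))) := by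
  intro N _ W _ K _ _ p _ κ γ hyp hirr hirrK
  haveI := hyp.isElliptic
  intro S hpS hbad hSN hSσ
  classical
  have hK : IsImaginaryQuadratic K := hyp.isImaginaryQuadratic
  haveI : IsTotallyComplex K := hK.isTotallyComplex
  have himag : ∀ w : NumberField.InfinitePlace K, w.IsComplex := fun w ↦ IsTotallyComplex.isComplex w
  have hanti : (κ.unitTwist (-1)).IsAnticyclotomic := hyp.anticyclotomic.unitTwist (-1)
  have hHeeg : SatisfiesHeegnerHypothesis N K := hyp.heegner
  have hN0 : N ≠ 0 := NeZero.ne N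
  have hdec : ∀ v ∈ S, ¬ (GreenbergSelmer.decomp v ≤ (κ.unitTwist (-1)).kerSubgroup) :=
    fun v hv ↦ ZpExtension.decomp_not_le_kerSubgroup_of_mem_or_mem hK (κ.unitTwist (-1)) hanti hHeeg hN0 hSN v hv
  -- (B4) §4: at every `v ∈ S` an element `g₀ ∈ Γ_{K_v}` with `κ⁻(g₀) = p^{s_v}` exactly
  have hsg : ∀ v ∈ S, ∃ (s : ℕ) (g₀ : absoluteGaloisGroup (v.adicCompletion K)),
      ((κ.unitTwist (-1)) (absGaloisRestrict K (v.adicCompletion K) g₀)).toAdd = ((p ^ s : ℕ) : ℤ_[p]) :=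
    fun v hv ↦ (κ.unitTwist (-1)).exists_toAdd_apply_absGaloisRestrict_eq_pow_of_not_decomp_le v (hdec v hv)
  choose! sv g₀ hg₀ using hsg
  refine ⟨S.sup (fun v ↦ 2 * p ^ sv v) + 1, fun m hm hle L hL hLS c₀ σ hσ₁ hσ hτl hτ₂ D e log hc₀ hτ hDe he_red
    h4' h5' h6' h7' h8' h9' v hvS hpv ↦ ?_⟩
  have hms : 2 * p ^ sv v < m :=
    lt_of_le_of_lt (Finset.le_sup (f := fun v ↦ 2 * p ^ sv v) hvS) (Nat.lt_of_lt_of_le (Nat.lt_succ_self _) hle)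
  letI := IwasawaAlgebra.isDomain_quotient_X_pow_add_C p hm
  letI := IwasawaAlgebra.isDiscreteValuationRing_quotient_X_pow_add_C p hm
  haveI := IwasawaAlgebra.EisensteinCoeff.isLocalRing_succ p hm
  letI := IwasawaAlgebra.EisensteinCoeff.algebraOfSpecSucc p m
  haveI := W.isScalarTower_algebraOfSpecSucc (K := K) (p := p) (m := m)
  letI := W.residueModuleSucc (K := K) (p := p) hm
  haveI := charZero_adicCompletion v
  -- the frame facts at the two places `v`, `σ•v` above `p`
  have hσpv : ((p : ℕ) : 𝓞 K) ∈ ((ConjugationDatum.ofLifts σ hσ₁ hσ _ hτl hτ₂).σ • v).asIdeal :=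
    (WeierstrassCurve.natCast_mem_smul_asIdeal_iff (K := K) (p := p) σ v).2 hpv
  have hgoodw : ∀ w : HeightOneSpectrum (𝓞 K), ((p : ℕ) : 𝓞 K) ∈ w.asIdeal → (W.baseChange K).HasGoodReductionAt w :=
    fun w hpw ↦ W.hasGoodReductionAt_baseChange_of_hasGoodReductionAtPrime hyp.ordinary.1 w hpw
  have hordw : ∀ w : HeightOneSpectrum (𝓞 K), ((p : ℕ) : 𝓞 K) ∈ w.asIdeal →
      ∃ P : localPoints (W.baseChange K) (w.adicCompletion K),
        (p : ℤ) • P = 0 ∧ P ∉ (W.baseChange K).localKernelOfReduction w := fun w hpw ↦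
    (W.baseChange K).exists_ordinaryPoint_local_of_not_dvd_frobeniusTraceAt w (hgoodw w hpw) hpw
      (W.not_dvd_frobeniusTraceAt_baseChange_of_isOrdinaryAt hyp.ordinary w hpw)
  -- the conjugated element for the twisted side (anticyclotomic sign)
  have hg₁ := ZpExtension.toAdd_apply_conj_absGaloisRestrict_inv_eq_of_anticyclotomic (κ.unitTwist (-1))
    (ConjugationDatum.ofLifts σ hσ₁ hσ _ hτl hτ₂)
    (fun g ↦ ZpExtension.toAdd_conjGalCMH_eq_neg (κ.unitTwist (-1)) hanti himag hτl hc₀ hτ g) v (hg₀ v hvS)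
  refine ⟨fun ζ hζ h0 ↦ ?_, fun ξ hξ h0 ↦ ?_⟩
  · exact W.eisensteinTower_mem_saturatedFamilies_of_forall_localCup_eq_zero_ofLifts' (κ.unitTwist (-1)) hm σ hσ₁ hσ _
      hτl hτ₂ D he_red hyp.ordinary (hgoodw v hpv) hpv (hordw v hpv) (hgoodw _ hσpv) hσpv (hordw _ hσpv)
      (fun k ↦ e (k + 1)) (fun k ↦ log (k + 1)) hDe (fun k ↦ h4' (k + 1)) (fun k ↦ h7' (k + 1)) (fun k ↦ h8' (k + 1))
      (fun k ↦ h9' (k + 1)) hg₁ hms hζ h0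
  · exact W.eisensteinTower_mem_saturatedFamilies_of_forall_localCup_flip_eq_zero_ofLifts' (κ.unitTwist (-1)) hm σ hσ₁ hσ _
      hτl hτ₂ D he_red hyp.ordinary (hgoodw v hpv) hpv (hordw v hpv) (hgoodw _ hσpv) hσpv (hordw _ hσpv)
      (fun k ↦ e (k + 1)) (fun k ↦ log (k + 1)) hDe (fun k ↦ h4' (k + 1)) (fun k ↦ h7' (k + 1)) (fun k ↦ h8' (k + 1))
      (fun k ↦ h9' (k + 1)) (hg₀ v hvS) hms hξ h0

end Summit.BirchSwinnertonDyer.BirchSwinnertonDyer.Theorems.HeegnerMuPartH4AtSAnnSat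

end
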